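import Mathlib
import HarnessLib
import Literature.MathematicalPhysics.QuantumLattice.GaugeGroups
import Summits.Ventures.LatticeQCDFlow.Exactness.SpectralKernelJacobianWeylShapeSU

/-!
# The torus map `diag d ↦ diag (f d)` of a MEASURABLE eigenvalue map is measurable

HONEST FRAMING: exact (Metropolis-corrected) sampling algorithms for lattice gauge theory;
figures of merit are autocorrelation/cost numbers at stated couplings and volumes; no
continuum-physics claim.

Venture `LatticeQCDFlow` (cell pub-lqcd), topic `Exactness`; FANOUT row 10 (`eng-equiv`, engine
`latflow.equiv` `spectral.spectral_kernel`).  NEW WORK of the cell, companion of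
`SpectralKernelMeasurableRecipe.lean`: the tree's `measurable_torusMap_of_continuousOn` asks the
eigenvalue map `f` to be continuous on the unimodular torus; the engine's `f` is only measurable
(discontinuous across alcove walls).  Here: `f` measurable ⇒ the torus map `fT : SΔ(N) → SΔ(N)`,
`diag d ↦ diag(f d)`, is measurable — through the measurable embeddings `SΔ(N) ↪ SU(N) ↪ Matrix` for
the Borel structures (the tree's σ-algebra on `SU(N)` is `borel`, identified with the subspace
σ-algebra by `BorelSpace.measurable_eq`).  Nothing is cited as a fact; no number; no definition.

* **`measurable_torusMap_of_measurable`**.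
-/

noncomputable section

namespace Summit.Ventures.LatticeQCDFlow.Exactness

open MeasureTheory Matrix Set Topology
open Literature.LinearAlgebra.Matrix

section TorusMapMeasurable

variable {m : Type} [Fintype m] [DecidableEq m]

/-- **The torus map of a MEASURABLE eigenvalue map is measurable**: if `fT : SΔ → SΔ` is
`diag d ↦ diag (f d)` with `f` measurable, then `fT` is measurable (no continuity of `f`). -/
theorem measurable_torusMap_of_measurable {f : (m → ℂ) → (m → ℂ)} (hfm : Measurable f)
    {fT : specialDiagonalTorus m → specialDiagonalTorus m}
    (hfT : ∀ t : specialDiagonalTorus m, ((fT t : Matrix.specialUnitaryGroup m ℂ) : Matrix m m ℂ) =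
      diagonal (f fun i => ((t : Matrix.specialUnitaryGroup m ℂ) : Matrix m m ℂ) i i)) :
    Measurable fT := by
  haveI : SecondCountableTopology (Matrix m m ℂ) := inferInstanceAs (SecondCountableTopology (m → m → ℂ))
  haveI : SecondCountableTopology (Matrix.specialUnitaryGroup m ℂ) :=
    Topology.IsEmbedding.subtypeVal.secondCountableTopology
  haveI : SecondCountableTopology (specialDiagonalTorus m) := secondCountableTopology_specialDiagonalTorus
  letI : MeasurableSpace (Matrix m m ℂ) := inferInstanceAs (MeasurableSpace (m → m → ℂ))
  haveI : BorelSpace (Matrix m m ℂ) := inferInstanceAs (BorelSpace (m → m → ℂ))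
  -- the matrix of `fT t` is a measurable function of `t`
  have hval : Continuous fun t : specialDiagonalTorus m => ((t : Matrix.specialUnitaryGroup m ℂ) : Matrix m m ℂ) :=
    continuous_subtype_val.comp continuous_subtype_val
  have hentry : ∀ i, Measurable fun t : specialDiagonalTorus m =>
      ((t : Matrix.specialUnitaryGroup m ℂ) : Matrix m m ℂ) i i := fun i =>
    ((continuous_apply i).comp ((continuous_apply i).comp hval)).measurable
  have hmat : Measurable fun t : specialDiagonalTorus m =>
      (((fT t : Matrix.specialUnitaryGroup m ℂ)) : Matrix m m ℂ) := by
    have heq : (fun t : specialDiagonalTorus m => (((fT t : Matrix.specialUnitaryGroup m ℂ)) : Matrix m m ℂ)) =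
        fun t : specialDiagonalTorus m => diagonal (f fun i => ((t : Matrix.specialUnitaryGroup m ℂ) : Matrix m m ℂ) i i) :=
      funext hfT
    rw [heq]
    refine measurable_pi_lambda _ fun i => measurable_pi_lambda _ fun j => ?_
    by_cases hij : i = j
    · subst hij
      simp only [diagonal_apply_eq]
      exact (measurable_pi_apply i).comp (hfm.comp (measurable_pi_lambda _ hentry))
    · simp only [diagonal_apply_ne _ hij, measurable_const]
  -- `SU ↪ Matrix` and `SΔ ↪ SU` are measurable embeddings for the Borel structures
  have hσ : (Subtype.instMeasurableSpace : MeasurableSpace (Matrix.specialUnitaryGroup m ℂ)) =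
      Matrix.specialUnitaryGroup.instMeasurableSpace :=
    @BorelSpace.measurable_eq _ _ Subtype.instMeasurableSpace (Subtype.borelSpace _)
  have hemb : MeasurableEmbedding (Subtype.val : Matrix.specialUnitaryGroup m ℂ → Matrix m m ℂ) := by
    have h0 := (IsClosed.isClosedEmbedding_subtypeVal (isCompact_iff_compactSpace.mpr
      (inferInstance : CompactSpace (Matrix.specialUnitaryGroup m ℂ))).isClosed).measurableEmbedding
    rwa [hσ] at h0
  have hSU : Measurable fun t : specialDiagonalTorus m => (fT t : Matrix.specialUnitaryGroup m ℂ) :=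
    hemb.measurable_comp_iff.mp hmat
  have hTclosed : IsClosed ((specialDiagonalTorus m : Subgroup (Matrix.specialUnitaryGroup m ℂ)) :
      Set (Matrix.specialUnitaryGroup m ℂ)) :=
    (isCompact_iff_compactSpace.mpr (inferInstance : CompactSpace (specialDiagonalTorus m))).isClosed
  exact (MeasurableEmbedding.subtype_coe hTclosed.measurableSet).measurable_comp_iff.mp hSU

end TorusMapMeasurable

end Summit.Ventures.LatticeQCDFlow.Exactness
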